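import Literature.LinearAlgebra.Matrix.JointEigenbasis

/-!
# Trace ratios `Tr(K Aˢ)/Tr(A^{s+r})` in an arbitrary unitary eigenbasis, with a simple top
# eigenvalue (the transfer-matrix limit in the joint eigenbasis of DKLM 2026, Theorem 23, Step 1)

Topic `LinearAlgebra/Matrix`, namespace `Literature.LinearAlgebra.Matrix`; a complex companion
of `NonnegSymmetricTraceLimit.lean`. Let `A` be a real matrix whose complexification is
diagonalised by a unitary `W` (`W W⋆ = W⋆ W = 1`, `A_ℂ W = W diag(d)`, `d` real — e.g. the joint
eigenbasis of `JointEigenbasis.lean`), with a *simple* top eigenvalue: `d i₀ = Λ > 0` and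
`|d k| < Λ` for `k ≠ i₀`. Then

* `trace_mul_cpx_pow_eq_sum`: `Tr(K A_ℂˢ) = ∑_k (W⋆ K W)_{kk} d_kˢ`;
* `tendsto_trace_mul_cpx_pow_div`: **`Tr(K A_ℂˢ) / Tr(A_ℂ^{s+r}) → (W⋆ K W)_{i₀i₀} / Λ^r`**;
* `star_mul_mul_cpx_pow_mul_mul_apply`: `(W⋆ (X A_ℂ^x Y) W)_{ii} = ∑_k (W⋆XW)_{ik} d_k^x (W⋆YW)_{ki}`,
  so that pair correlations `lim Tr(X A^x Y Aˢ)/Tr(A^{s+r})` expand over the eigenbasis `W` with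
  the phases of any operator co-diagonalised by `W` available — the computation
  `Φ = v_0† S T(π/2)^{x} T(0)^{-y} S v_0 = -∑_{k>0} |v_k† S v_0|² Λ_k(π/2)^x Λ_k(0)^{-y}` of
  Duminil-Copin–Kozlowski–Lammers–Manolescu, Theorem 23, Step 1.

## References

* H. Duminil-Copin, K. K. Kozlowski, P. Lammers, I. Manolescu, arXiv:2603.06268 (2026), Part III
  §1 eq. (cylop) and §3, proof of Theorem 23, Step 1. [DKLM2026SixVertexGFF]
-/

noncomputable section

open Matrix Finset Filter Topology

namespace Literature.LinearAlgebra.Matrix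

variable {n : Type*} [Fintype n] [DecidableEq n]

/-! ### Traces and powers in a unitary eigenbasis -/

omit [DecidableEq n] in
/-- `Tr(M_ℂ) = Tr(M)`. [folklore] -/
theorem trace_cpx (M : Matrix n n ℝ) : (cpx M).trace = ((M.trace : ℝ) : ℂ) := by
  simp [Matrix.trace, cpx_apply]

/-- From `A_ℂ W = W D` and `W W⋆ = 1`: `A_ℂ = W D W⋆`. [folklore] -/
theorem cpx_eq_conj_of_mul_eq {A : Matrix n n ℝ} {W : Matrix n n ℂ} {d : n → ℝ}
    (hWW : W * star W = 1) (hAW : cpx A * W = W * diagonal (fun k => (d k : ℂ))) :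
    cpx A = W * diagonal (fun k => (d k : ℂ)) * star W := by
  calc cpx A = cpx A * (W * star W) := by rw [hWW, Matrix.mul_one]
    _ = W * diagonal (fun k => (d k : ℂ)) * star W := by rw [← Matrix.mul_assoc, hAW]

/-- Powers: `A_ℂˢ = W Dˢ W⋆`. [folklore] -/
theorem cpx_pow_eq_conj {A : Matrix n n ℝ} {W : Matrix n n ℂ} {d : n → ℝ}
    (hWW : W * star W = 1) (hW'W : star W * W = 1)
    (hAW : cpx A * W = W * diagonal (fun k => (d k : ℂ))) (s : ℕ) :
    cpx A ^ s = W * diagonal (fun k => (d k : ℂ) ^ s) * star W := by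
  induction s with
  | zero =>
    simp only [pow_zero, diagonal_one, Matrix.mul_one]
    exact hWW.symm
  | succ s ih =>
    rw [pow_succ, ih, cpx_eq_conj_of_mul_eq hWW hAW]
    have h : W * diagonal (fun k => (d k : ℂ) ^ s) * star W * (W * diagonal (fun k => (d k : ℂ)) * star W) =
        W * (diagonal (fun k => (d k : ℂ) ^ s) * (star W * W) * diagonal (fun k => (d k : ℂ))) * star W := by
      simp only [Matrix.mul_assoc]
    rw [h, hW'W, Matrix.mul_one, diagonal_mul_diagonal]
    rfl

/-- **`Tr(K A_ℂˢ) = ∑_k (W⋆ K W)_{kk} d_kˢ`** in any unitary eigenbasis. [folklore] -/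
theorem trace_mul_cpx_pow_eq_sum {A : Matrix n n ℝ} {W : Matrix n n ℂ} {d : n → ℝ}
    (hWW : W * star W = 1) (hW'W : star W * W = 1)
    (hAW : cpx A * W = W * diagonal (fun k => (d k : ℂ))) (K : Matrix n n ℂ) (s : ℕ) :
    (K * cpx A ^ s).trace = ∑ k, (star W * K * W) k k * (d k : ℂ) ^ s := by
  rw [cpx_pow_eq_conj hWW hW'W hAW s,
    show K * (W * diagonal (fun k => (d k : ℂ) ^ s) * star W) =
      (K * W * diagonal (fun k => (d k : ℂ) ^ s)) * star W by simp only [Matrix.mul_assoc],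
    Matrix.trace_mul_comm,
    show star W * (K * W * diagonal fun k => (d k : ℂ) ^ s) =
      (star W * K * W) * diagonal (fun k => (d k : ℂ) ^ s) by simp only [Matrix.mul_assoc]]
  simp [Matrix.trace, Matrix.mul_diagonal]

/-- `Tr(A_ℂˢ) = ∑_k d_kˢ`. [folklore] -/
theorem trace_cpx_pow_eq_sum {A : Matrix n n ℝ} {W : Matrix n n ℂ} {d : n → ℝ}
    (hWW : W * star W = 1) (hW'W : star W * W = 1)
    (hAW : cpx A * W = W * diagonal (fun k => (d k : ℂ))) (s : ℕ) :
    (cpx A ^ s).trace = ∑ k, (d k : ℂ) ^ s := by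
  have h := trace_mul_cpx_pow_eq_sum hWW hW'W hAW 1 s
  rw [Matrix.one_mul] at h
  rw [h]
  refine sum_congr rfl fun k _ => ?_
  rw [Matrix.mul_one, hW'W, Matrix.one_apply_eq, one_mul]

/-- The diagonal entries of `W⋆ (X A_ℂ^x Y) W`:
`(W⋆ X A^x Y W)_{ii} = ∑_k (W⋆XW)_{ik} d_k^x (W⋆YW)_{ki}`. [folklore] -/
theorem star_mul_mul_cpx_pow_mul_mul_apply {A : Matrix n n ℝ} {W : Matrix n n ℂ} {d : n → ℝ}
    (hWW : W * star W = 1) (hW'W : star W * W = 1)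
    (hAW : cpx A * W = W * diagonal (fun k => (d k : ℂ))) (X Y : Matrix n n ℂ) (x : ℕ) (i : n) :
    (star W * (X * cpx A ^ x * Y) * W) i i =
      ∑ k, (star W * X * W) i k * (d k : ℂ) ^ x * (star W * Y * W) k i := by
  have hconj : star W * (X * cpx A ^ x * Y) * W =
      star W * X * W * diagonal (fun k => (d k : ℂ) ^ x) * (star W * Y * W) := by
    rw [cpx_pow_eq_conj hWW hW'W hAW x]
    have h1 : star W * (X * (W * diagonal (fun k => (d k : ℂ) ^ x) * star W) * Y) * W =
        star W * X * W * diagonal (fun k => (d k : ℂ) ^ x) * (star W * Y * W) := by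
      simp only [Matrix.mul_assoc]
    exact h1
  rw [hconj, Matrix.mul_apply]
  refine sum_congr rfl fun k _ => ?_
  rw [Matrix.mul_diagonal]

/-! ### The limit with a simple top eigenvalue -/

/-- **The transfer-matrix limit in a unitary eigenbasis with a simple top eigenvalue**:
if `d i₀ = Λ > 0` and `|d k| < Λ` for `k ≠ i₀`, then for every `K` and `r`,
`Tr(K A_ℂˢ) / Tr(A_ℂ^{s+r}) → (W⋆ K W)_{i₀i₀} / Λ^r` as `s → ∞` (the `M → ∞` limit of
`Tr(𝔬 t^{M-r})/Tr(t^M)` read in the joint eigenbasis of `t` and `T(0)`).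
[cite: DKLM2026SixVertexGFF, Part III §1 eq. (cylop) and §3 (proof of Theorem 23, Step 1)] -/
theorem tendsto_trace_mul_cpx_pow_div {A : Matrix n n ℝ} {W : Matrix n n ℂ} {d : n → ℝ}
    (hWW : W * star W = 1) (hW'W : star W * W = 1)
    (hAW : cpx A * W = W * diagonal (fun k => (d k : ℂ))) {Λ : ℝ} (hΛ : 0 < Λ) {i₀ : n}
    (htop : d i₀ = Λ) (hlt : ∀ k, k ≠ i₀ → |d k| < Λ) (K : Matrix n n ℂ) (r : ℕ) :
    Tendsto (fun s : ℕ => (K * cpx A ^ s).trace / (cpx A ^ (s + r)).trace) atTop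
      (𝓝 ((star W * K * W) i₀ i₀ / (Λ : ℂ) ^ r)) := by
  set c : n → ℂ := fun k => (star W * K * W) k k with hc
  -- normalised powers converge to the indicator of `i₀`
  have hlim : ∀ k, Tendsto (fun s : ℕ => ((d k : ℂ) / Λ) ^ s) atTop
      (𝓝 (if k = i₀ then 1 else 0)) := by
    intro k
    by_cases h : k = i₀
    · subst h
      rw [if_pos rfl, htop, div_self (by exact_mod_cast hΛ.ne')]
      simp
    · rw [if_neg h]
      apply tendsto_pow_atTop_nhds_zero_of_norm_lt_one
      rw [norm_div, Complex.norm_real, Complex.norm_real, Real.norm_eq_abs, Real.norm_eq_abs,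
        abs_of_pos hΛ, div_lt_one hΛ]
      exact hlt k h
  have hnumlim : Tendsto (fun s : ℕ => ∑ k, c k * ((d k : ℂ) / Λ) ^ s) atTop
      (𝓝 (∑ k, c k * if k = i₀ then 1 else 0)) :=
    tendsto_finsetSum _ fun k _ => (hlim k).const_mul (c k)
  have hdenlim : Tendsto (fun s : ℕ => (Λ : ℂ) ^ r * ∑ k, ((d k : ℂ) / Λ) ^ (s + r)) atTop
      (𝓝 ((Λ : ℂ) ^ r * ∑ k, (if k = i₀ then 1 else 0 : ℂ))) :=
    (tendsto_finsetSum _ fun k _ => (hlim k).comp (tendsto_add_atTop_nat r)).const_mul _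
  have hnum_eq : (∑ k, c k * if k = i₀ then 1 else 0) = c i₀ := by
    simp [Finset.sum_ite_eq']
  have hden_eq : ((Λ : ℂ) ^ r * ∑ k, (if k = i₀ then 1 else 0 : ℂ)) = (Λ : ℂ) ^ r := by
    simp [Finset.sum_ite_eq']
  have hΛC : (Λ : ℂ) ≠ 0 := by exact_mod_cast hΛ.ne'
  have hden_ne : (Λ : ℂ) ^ r ≠ 0 := pow_ne_zero _ hΛC
  rw [hnum_eq] at hnumlim
  rw [hden_eq] at hdenlim
  have hratio := hnumlim.div hdenlim hden_ne
  refine hratio.congr' ?_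
  filter_upwards with s
  simp only [Pi.div_apply]
  rw [trace_mul_cpx_pow_eq_sum hWW hW'W hAW K s, trace_cpx_pow_eq_sum hWW hW'W hAW (s + r)]
  have hΛs : (Λ : ℂ) ^ s ≠ 0 := pow_ne_zero _ hΛC
  have e1 : ∑ k, c k * ((d k : ℂ) / Λ) ^ s = (∑ k, c k * (d k : ℂ) ^ s) / (Λ : ℂ) ^ s := by
    rw [Finset.sum_div]
    exact Finset.sum_congr rfl fun k _ => by rw [div_pow]; ring
  have e2 : (Λ : ℂ) ^ r * ∑ k, ((d k : ℂ) / Λ) ^ (s + r) = (∑ k, (d k : ℂ) ^ (s + r)) / (Λ : ℂ) ^ s := by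
    rw [Finset.mul_sum, Finset.sum_div]
    refine Finset.sum_congr rfl fun k _ => ?_
    rw [div_pow, pow_add, pow_add]
    field_simp
  rw [e1, e2, div_div_div_cancel_right₀ hΛs]

/-- **Clustering / pair form of the limit**: for `K = X A_ℂ^x Y`,
`Tr(X A^x Y Aˢ)/Tr(A^{s+r}) → (∑_k (W⋆XW)_{i₀k} d_k^x (W⋆YW)_{ki₀}) / Λ^r`.
[cite: DKLM2026SixVertexGFF, proof of Theorem 23, Step 1] -/
theorem tendsto_trace_mul_cpx_pow_mul_mul_cpx_pow_div {A : Matrix n n ℝ} {W : Matrix n n ℂ}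
    {d : n → ℝ} (hWW : W * star W = 1) (hW'W : star W * W = 1)
    (hAW : cpx A * W = W * diagonal (fun k => (d k : ℂ))) {Λ : ℝ} (hΛ : 0 < Λ) {i₀ : n}
    (htop : d i₀ = Λ) (hlt : ∀ k, k ≠ i₀ → |d k| < Λ) (X Y : Matrix n n ℂ) (x r : ℕ) :
    Tendsto (fun s : ℕ => (X * cpx A ^ x * Y * cpx A ^ s).trace / (cpx A ^ (s + r)).trace) atTop
      (𝓝 ((∑ k, (star W * X * W) i₀ k * (d k : ℂ) ^ x * (star W * Y * W) k i₀) / (Λ : ℂ) ^ r)) := by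
  rw [← star_mul_mul_cpx_pow_mul_mul_apply hWW hW'W hAW X Y x i₀]
  exact tendsto_trace_mul_cpx_pow_div hWW hW'W hAW hΛ htop hlt (X * cpx A ^ x * Y) r

end Literature.LinearAlgebra.Matrix

end
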